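import Summits.CriticalPhenomena.PercolationContinuityZ3.Theorems.PercNearOneGluingNoHeavyLowerTailSahiSliceMinimum

/-!
# `NoHeavyLowerTail` (crux stmt-CriticalPhenomena-4575), Sahi programme P2 (gen 16): THE BERNSTEIN MINIMUM PRINCIPLE —
# the module-stable form of the slice minimum principle, its reduction, and the first proved instances (diagonal triples)

Support file (`--supports stmt-CriticalPhenomena-4575`; companion of `…SahiSliceMinimum`).  Along a coin `e` with bias `s`,
`E₃(μ_{p[e↦s]}; f,g,h)` is a cubic in `s` (tree: `sahiE_three_update_eq` / `cubicE3`, section moments `secEx`).  Here: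

* `pat`, `bern₀ … bern₃` — its four BERNSTEIN COEFFICIENTS in closed form: `bern_j` is the average, over the patterns
  `c ∈ {0,1}³` with `j` ones, of the three-copy polarisation
  `P(c) = 2X_{c₀}(fgh) − [X_{c₁}(f)X_{c₀}(gh) + X_{c₁}(g)X_{c₀}(fh) + X_{c₁}(h)X_{c₀}(fg)] + X_{c₀}(f)X_{c₁}(g)X_{c₂}(h)`
  (`X_b = secEx p e · b`); `sahiE_three_update_eq_bernstein`: `E₃(μ_{p[e↦s]}) = Σ_j C(3,j)s^j(1−s)^{3−j}·bern_j`;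
  the endpoints are the two facet values (`bern₀_eq`, `bern₃_eq`).
* **`BernsteinMinimumPrinciple`** (@[conjecture]; this seat, census-clean: all triples of up-sets of `{0,1}³`/`{0,1}⁴` × 100/20
  product measures (16·10⁶ exact checks), `{0,1}⁵` uniform 10⁸ sampled [exhaustive: kit j152730], random `k = 5,6` (4·10⁵),
  orders `n = 2,3,4` on `{0,1}³`): for EVERY live coin `e`, the two MIDDLE coefficients `bern₁^e, bern₂^e` are `≥` some facet
  value `E₃(μ_{p[e'↦b]})` at a live coin `e'` — i.e. the minimum of ALL `4k` Bernstein control values over all axes is attained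
  at an ENDPOINT (a facet).  By Bézier subdivision this form is inherited by sub-segments, hence by module compositions
  (doubling), unlike the bare slice principle; `sliceMinimumPrinciple_three_of_bernstein`: it implies `SliceMinimumPrinciple 3`
  (the fibre value is a convex combination of its four control values), hence Kahn's Conjecture 5 and Sahi's `C₃`.
* FIRST PROVED INSTANCES (the census extremisers): for a DIAGONAL triple `(U,U,U)` the fibre is `φ(m(s))`, `φ(m) = m(1−m)(2−m)`
  concave on `[0,1]`, `m(s)` affine, so the control polygon is concave (`bern₀−2bern₁+bern₂ = Δ²(m₀−1) ≤ 0`,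
  `bern₁−2bern₂+bern₃ = Δ²(m₁−1) ≤ 0`) and both middle coefficients dominate the smaller endpoint:
  `bernstein_diag` — the Bernstein (hence slice) minimum principle holds at EVERY live coin of every diagonal triple.
HONEST LABEL: conjectures typed with kernel reductions and one proved family; `C₃` remains OPEN.
-/

noncomputable section

open scoped Classical

namespace Summit.CriticalPhenomena.PercolationContinuityZ3.Theorems

open Finset Function
open Literature.Combinatorics.Sahi2008
open Literature.Probability.Percolation.DecisionTree (ind ind_of_mem ind_of_not_mem ind_nonneg)

namespace SahiSliceMinimum

variable {ι : Type*} [Fintype ι]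

/-! ### The four Bernstein coefficients of the fibre cubic -/

/-- The three-copy polarisation of Sahi's cubic kernel at coin `e`: copies `ω, ω′, ω″` conditioned to the facets
`c₀, c₁, c₂`, with section moments `X_b = secEx p e · b`. [this work] -/
def pat (p : ι → unitInterval) (e : ι) (f g h : Set ι → ℝ) (c₀ c₁ c₂ : Bool) : ℝ :=
  2 * secEx p e (f * g * h) c₀ -
    (secEx p e f c₁ * secEx p e (g * h) c₀ + secEx p e g c₁ * secEx p e (f * h) c₀ +
      secEx p e h c₁ * secEx p e (f * g) c₀) +
    secEx p e f c₀ * secEx p e g c₁ * secEx p e h c₂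

/-- `bern₀` = the pattern with no `1` (the `x_e = 0` facet value). [this work] -/
def bern₀ (p : ι → unitInterval) (e : ι) (f g h : Set ι → ℝ) : ℝ := pat p e f g h false false false

/-- `bern₁` = the average of the three patterns with one `1`. [this work] -/
def bern₁ (p : ι → unitInterval) (e : ι) (f g h : Set ι → ℝ) : ℝ :=
  (pat p e f g h true false false + pat p e f g h false true false + pat p e f g h false false true) / 3

/-- `bern₂` = the average of the three patterns with two `1`s. [this work] -/
def bern₂ (p : ι → unitInterval) (e : ι) (f g h : Set ι → ℝ) : ℝ :=
  (pat p e f g h true true false + pat p e f g h true false true + pat p e f g h false true true) / 3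

/-- `bern₃` = the pattern with three `1`s (the `x_e = 1` facet value). [this work] -/
def bern₃ (p : ι → unitInterval) (e : ι) (f g h : Set ι → ℝ) : ℝ := pat p e f g h true true true

/-- **Bernstein form of the fibre cubic**: `E₃(μ_{p[e↦s]}; f,g,h) = (1−s)³β₀ + 3s(1−s)²β₁ + 3s²(1−s)β₂ + s³β₃`. [this work] -/
theorem sahiE_three_update_eq_bernstein (p : ι → unitInterval) (e : ι) (s : unitInterval) (f g h : Set ι → ℝ) :
    sahiE (bernoulliWeight (update p e s)) 3 ![f, g, h] =
      (1 - (s : ℝ)) ^ 3 * bern₀ p e f g h + 3 * (s : ℝ) * (1 - (s : ℝ)) ^ 2 * bern₁ p e f g h +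
        3 * (s : ℝ) ^ 2 * (1 - (s : ℝ)) * bern₂ p e f g h + (s : ℝ) ^ 3 * bern₃ p e f g h := by
  rw [sahiE_three_update_eq]
  simp only [cubicE3, bern₀, bern₁, bern₂, bern₃, pat]
  ring

/-- The fibre at `s = 0` is `bern₀` (the `x_e = 0` facet value). [this work] -/
theorem bern₀_eq (p : ι → unitInterval) (e : ι) (f g h : Set ι → ℝ) :
    sahiE (bernoulliWeight (update p e 0)) 3 ![f, g, h] = bern₀ p e f g h := by
  rw [sahiE_three_update_eq_bernstein, Set.Icc.coe_zero]; ring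

/-- The fibre at `s = 1` is `bern₃` (the `x_e = 1` facet value). [this work] -/
theorem bern₃_eq (p : ι → unitInterval) (e : ι) (f g h : Set ι → ℝ) :
    sahiE (bernoulliWeight (update p e 1)) 3 ![f, g, h] = bern₃ p e f g h := by
  rw [sahiE_three_update_eq_bernstein, Set.Icc.coe_one]; ring

/-- A cubic in Bernstein form on `[0,1]` is at least the least of its four control values. [folklore] -/
theorem bernstein_ge_min {s m b₀ b₁ b₂ b₃ : ℝ} (hs0 : 0 ≤ s) (hs1 : s ≤ 1) (h0 : m ≤ b₀) (h1 : m ≤ b₁) (h2 : m ≤ b₂)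
    (h3 : m ≤ b₃) :
    m ≤ (1 - s) ^ 3 * b₀ + 3 * s * (1 - s) ^ 2 * b₁ + 3 * s ^ 2 * (1 - s) * b₂ + s ^ 3 * b₃ := by
  have e1 : (1 - s) ^ 3 + 3 * s * (1 - s) ^ 2 + 3 * s ^ 2 * (1 - s) + s ^ 3 = 1 := by ring
  have hs' : 0 ≤ 1 - s := sub_nonneg.2 hs1
  nlinarith [mul_nonneg (pow_nonneg hs' 3) (sub_nonneg.2 h0),
    mul_nonneg (mul_nonneg (mul_nonneg (by norm_num : (0:ℝ) ≤ 3) hs0) (pow_nonneg hs' 2)) (sub_nonneg.2 h1),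
    mul_nonneg (mul_nonneg (mul_nonneg (by norm_num : (0:ℝ) ≤ 3) (pow_nonneg hs0 2)) hs') (sub_nonneg.2 h2),
    mul_nonneg (pow_nonneg hs0 3) (sub_nonneg.2 h3)]

/-! ### The Bernstein minimum principle (typed) and its reduction to the slice minimum principle -/

/-- **THE BERNSTEIN MINIMUM PRINCIPLE** (conjecture of this seat, census-clean; see the file header): for three increasing
events, at EVERY live coin `e` each MIDDLE Bernstein coefficient of the fibre cubic dominates SOME facet value at a live
coin — "the least of all `4k` control values over all axes is a facet value".  Module-stable (Bézier subdivision).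
An obligation / hypothesis; never import it as a fact. [this work] [status: open; conjecture] -/
@[conjecture] def BernsteinMinimumPrinciple : Prop :=
  ∀ (ι : Type) [Fintype ι] (p : ι → unitInterval) (U : Fin 3 → Set (Set ι)),
    (∀ j, IsUpperSet (U j)) → ∀ e ∈ liveSet p,
      (∃ e' ∈ liveSet p, ∃ b : unitInterval, ((b : ℝ) = 0 ∨ (b : ℝ) = 1) ∧
        sahiE (bernoulliWeight (update p e' b)) 3 (fun j => ind (U j)) ≤
          bern₁ p e (ind (U 0)) (ind (U 1)) (ind (U 2))) ∧
      (∃ e' ∈ liveSet p, ∃ b : unitInterval, ((b : ℝ) = 0 ∨ (b : ℝ) = 1) ∧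
        sahiE (bernoulliWeight (update p e' b)) 3 (fun j => ind (U j)) ≤
          bern₂ p e (ind (U 0)) (ind (U 1)) (ind (U 2)))

/-- **The Bernstein minimum principle implies the slice minimum principle of order 3** (hence Kahn's Conjecture 5 and
Sahi's `C₃`, by `…SahiSliceMinimum`): at any live coin the fibre value is a convex combination of its four control values,
each of which dominates some live facet. [this work] -/
theorem sliceMinimumPrinciple_three_of_bernstein (h : BernsteinMinimumPrinciple) : SliceMinimumPrinciple 3 := by
  intro ι _ p U hU hlive
  obtain ⟨e, he⟩ := hlive
  obtain ⟨⟨e₁, he₁, b₁, hb₁, hle₁⟩, ⟨e₂, he₂, b₂, hb₂, hle₂⟩⟩ := h ι p U hU e he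
  have hF : (fun j => ind (U j)) = ![ind (U 0), ind (U 1), ind (U 2)] := by
    funext j; fin_cases j <;> rfl
  rw [hF] at hle₁ hle₂ ⊢
  set s : unitInterval := p e with hs
  have hp : p = update p e s := by rw [hs, update_eq_self]
  have hG : sahiE (bernoulliWeight p) 3 ![ind (U 0), ind (U 1), ind (U 2)] =
      sahiE (bernoulliWeight (update p e s)) 3 ![ind (U 0), ind (U 1), ind (U 2)] := by rw [← hp]
  set f := ind (U 0); set g := ind (U 1); set k := ind (U 2)
  -- the least of the four control values
  have hmG : min (min (bern₀ p e f g k) (bern₃ p e f g k)) (min (bern₁ p e f g k) (bern₂ p e f g k)) ≤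
      sahiE (bernoulliWeight p) 3 ![f, g, k] := by
    rw [hG, sahiE_three_update_eq_bernstein]
    exact bernstein_ge_min s.2.1 s.2.2 (le_trans (min_le_left _ _) (min_le_left _ _))
      (le_trans (min_le_right _ _) (min_le_left _ _)) (le_trans (min_le_right _ _) (min_le_right _ _))
      (le_trans (min_le_left _ _) (min_le_right _ _))
  rcases min_choice (min (bern₀ p e f g k) (bern₃ p e f g k)) (min (bern₁ p e f g k) (bern₂ p e f g k)) with h03 | h12
  · rcases min_choice (bern₀ p e f g k) (bern₃ p e f g k) with h0 | h3
    · refine ⟨e, he, 0, Or.inl Set.Icc.coe_zero, ?_⟩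
      rw [bern₀_eq]; rw [h03, h0] at hmG; exact hmG
    · refine ⟨e, he, 1, Or.inr Set.Icc.coe_one, ?_⟩
      rw [bern₃_eq]; rw [h03, h3] at hmG; exact hmG
  · rcases min_choice (bern₁ p e f g k) (bern₂ p e f g k) with h1 | h2
    · refine ⟨e₁, he₁, b₁, hb₁, le_trans hle₁ ?_⟩
      rw [h12, h1] at hmG; exact hmG
    · refine ⟨e₂, he₂, b₂, hb₂, le_trans hle₂ ?_⟩
      rw [h12, h2] at hmG; exact hmG

/-- **The Bernstein minimum principle implies Kahn's Conjecture 5.** [this work] -/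
theorem kahnConjecture_of_bernstein (h : BernsteinMinimumPrinciple) : KahnConjecture :=
  kahnConjecture_of_sliceMinimumPrinciple (sliceMinimumPrinciple_three_of_bernstein h)

/-! ### First proved instances: diagonal triples `(U,U,U)` — concavity of `m(1−m)(2−m)` -/

omit [Fintype ι] in
/-- Indicators are idempotent. [folklore] -/
theorem ind_mul_self (U : Set (Set ι)) : ind U * ind U = ind U := by
  funext ω
  by_cases h : ω ∈ U
  · simp [Pi.mul_apply, ind_of_mem h]
  · simp [Pi.mul_apply, ind_of_not_mem h]

/-- The section moments of the constant `1` are both `1`. [folklore] -/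
theorem secEx_one (p : ι → unitInterval) (e : ι) (b : Bool) : secEx p e (1 : Set ι → ℝ) b = 1 := by
  have h1 : ∀ b', secEx p e (1 : Set ι → ℝ) b' = secEx p e (1 : Set ι → ℝ) true := by
    intro b'; simp [secEx]
  have hx := ex_update_eq p e 1 (1 : Set ι → ℝ)
  rw [ex_one (sum_bernoulliWeight _), Set.Icc.coe_one] at hx
  rw [h1 b]
  linarith

/-- Section moments of an indicator lie in `[0,1]`. [folklore] -/
theorem secEx_ind_mem (p : ι → unitInterval) (e : ι) (U : Set (Set ι)) (b : Bool) :
    0 ≤ secEx p e (ind U) b ∧ secEx p e (ind U) b ≤ 1 := by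
  constructor
  · unfold secEx
    exact sum_nonneg fun ω _ => mul_nonneg (offWeight_nonneg p e ω) (ind_nonneg U _)
  · rw [← secEx_one p e b]
    unfold secEx
    refine sum_le_sum fun ω _ => mul_le_mul_of_nonneg_left ?_ (offWeight_nonneg p e ω)
    by_cases h : (if b then insert e ω else ω) ∈ U
    · rw [ind_of_mem h]; simp
    · rw [ind_of_not_mem h]; simp

/-- **The Bernstein (hence the slice) minimum principle holds at every live coin of a DIAGONAL triple `(U,U,U)`**:
with `m_b = X_b(1_U)` (`m₀ ≤ m₁` for increasing `U`), the control polygon of the fibre `φ(m(s))`, `φ(m) = m(1−m)(2−m)`,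
is concave — `bern₀ − 2bern₁ + bern₂ = (m₁−m₀)²(m₀−1) ≤ 0`, `bern₁ − 2bern₂ + bern₃ = (m₁−m₀)²(m₁−1) ≤ 0` — so both middle
coefficients are at least the smaller endpoint (a facet value at the same coin). [this work] -/
theorem bernstein_diag (p : ι → unitInterval) (e : ι) {U : Set (Set ι)} (hU : IsUpperSet U) :
    min (bern₀ p e (ind U) (ind U) (ind U)) (bern₃ p e (ind U) (ind U) (ind U)) ≤
        bern₁ p e (ind U) (ind U) (ind U) ∧
      min (bern₀ p e (ind U) (ind U) (ind U)) (bern₃ p e (ind U) (ind U) (ind U)) ≤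
        bern₂ p e (ind U) (ind U) (ind U) := by
  have hmul : ind U * ind U = ind U := ind_mul_self U
  obtain ⟨h00, h01⟩ := secEx_ind_mem p e U false
  obtain ⟨h10, h11⟩ := secEx_ind_mem p e U true
  have hle : secEx p e (ind U) false ≤ secEx p e (ind U) true := secEx_ind_mono p e hU
  set a := secEx p e (ind U) false
  set b := secEx p e (ind U) true
  -- second differences of the control polygon
  have d1 : bern₀ p e (ind U) (ind U) (ind U) - 2 * bern₁ p e (ind U) (ind U) (ind U) +
      bern₂ p e (ind U) (ind U) (ind U) = (b - a) ^ 2 * (a - 1) := by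
    simp only [bern₀, bern₁, bern₂, pat, hmul]; ring
  have d2 : bern₁ p e (ind U) (ind U) (ind U) - 2 * bern₂ p e (ind U) (ind U) (ind U) +
      bern₃ p e (ind U) (ind U) (ind U) = (b - a) ^ 2 * (b - 1) := by
    simp only [bern₁, bern₂, bern₃, pat, hmul]; ring
  have hd1 : (b - a) ^ 2 * (a - 1) ≤ 0 := mul_nonpos_of_nonneg_of_nonpos (sq_nonneg _) (by linarith)
  have hd2 : (b - a) ^ 2 * (b - 1) ≤ 0 := mul_nonpos_of_nonneg_of_nonpos (sq_nonneg _) (by linarith)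
  constructor
  · rcases le_total (bern₀ p e (ind U) (ind U) (ind U)) (bern₃ p e (ind U) (ind U) (ind U)) with h | h
    · rw [min_eq_left h]; nlinarith
    · rw [min_eq_right h]; nlinarith
  · rcases le_total (bern₀ p e (ind U) (ind U) (ind U)) (bern₃ p e (ind U) (ind U) (ind U)) with h | h
    · rw [min_eq_left h]; nlinarith
    · rw [min_eq_right h]; nlinarith

/-- **Hence the slice minimum principle for diagonal triples, at every live coin**: some facet `(e,b)`, `b ∈ {0,1}`, of
the SAME coin has `E₃ ≤ E₃(μ_p; 1_U,1_U,1_U)`. [this work] -/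
theorem sliceMinimum_diag (p : ι → unitInterval) {U : Set (Set ι)} (hU : IsUpperSet U) (e : ι) :
    ∃ b : unitInterval, ((b : ℝ) = 0 ∨ (b : ℝ) = 1) ∧
      sahiE (bernoulliWeight (update p e b)) 3 ![ind U, ind U, ind U] ≤
        sahiE (bernoulliWeight p) 3 ![ind U, ind U, ind U] := by
  set s : unitInterval := p e with hs
  have hp : p = update p e s := by rw [hs, update_eq_self]
  have hG : sahiE (bernoulliWeight p) 3 ![ind U, ind U, ind U] =
      sahiE (bernoulliWeight (update p e s)) 3 ![ind U, ind U, ind U] := by rw [← hp]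
  obtain ⟨h1, h2⟩ := bernstein_diag p e hU
  have hmG : min (bern₀ p e (ind U) (ind U) (ind U)) (bern₃ p e (ind U) (ind U) (ind U)) ≤
      sahiE (bernoulliWeight p) 3 ![ind U, ind U, ind U] := by
    rw [hG, sahiE_three_update_eq_bernstein]
    exact bernstein_ge_min s.2.1 s.2.2 (min_le_left _ _) h1 h2 (min_le_right _ _)
  rcases min_choice (bern₀ p e (ind U) (ind U) (ind U)) (bern₃ p e (ind U) (ind U) (ind U)) with h0 | h3
  · exact ⟨0, Or.inl Set.Icc.coe_zero, by rw [bern₀_eq]; rw [h0] at hmG; exact hmG⟩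
  · exact ⟨1, Or.inr Set.Icc.coe_one, by rw [bern₃_eq]; rw [h3] at hmG; exact hmG⟩

end SahiSliceMinimum

end Summit.CriticalPhenomena.PercolationContinuityZ3.Theorems
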